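import Mathlib

/-!
# NE7EJDefectSpectral — row NE7 (node U5), candidate route HOM, variant H1L-EJ, item EJ-1b′ (T1)–(T3′): LENS 1's ARCHITECTURE FOR (cc′)(ii)
# IN KERNEL, ABSTRACTLY — «(MI) EF ≥ φ(Hess_f) as forms» ∧ «(LL) no physical spectrum of Hess_f in (−m, m)» ∧ «φ even, non-decreasing in |x|»
# ⟹ `λ_min(EF|phys) ≥ φ(m)`; the Padé family `φ_a(x) = ½x²∕(1 + |x|∕a)²` and the budget `φ₂(f(1 − βf)) ≥ 2ε² − (4 + 8β)ε³` (`f = 2ε`)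

Lineage `b2b-balaban-t4-ne7-p2` (CRUX PROVER NE7 #2 = C-HOM°'s kernel hand), generation 81; file 121.  Mathlib-only imports.

SOURCE (lens 1 = `t4-ne7-idea-1`, gen 67 `DEFECT-VS-HESSIAN-NOTE.md` 9e7cf2b6f8adbc99 §4 ∕ ROUTES-NE7 ▶v3.163 (5), ▶v3.164 (v)): «ARCHITECTURE FOR
(cc′)(ii), chosen over a Feshbach proof because it needs NO eigenvector localisation, NO weighted-coupling lemma and NO explicit projector onto phys:
(MI₂) «EF(ε) ≥ φ₂(Hess_f(ε)) as forms on ALL fine 1-forms» (both sides kill gauge modes …) ∧ (LL_β) «spec(Hess_f(ε)|phys) ∩ (−f(1 − βf), f(1 − βf))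
= ∅» ⇒ (phys reduces Hess_f; φ₂ even, increasing in |x|) λ_min(EF|phys) ≥ φ₂(f(1 − βf)) = 2ε²(1 − 2βε)²∕(1 + ε − 2βε²)² ≥ 2ε² − (4 + 8β)ε³, i.e.
(cc′)(ii) with C = 4 + 8β (family φ_a: C = 8∕a + 8β …)».  THIS FILE types the implication once and for all, for a real finite-dimensional inner
product space `E`, a self-adjoint `H` GIVEN WITH an orthonormal eigenbasis `b` adapted to the reducing subspace (`phys = span{b_i : i ∈ S}` —
the spectral theorem for `H|phys ⊕ H|phys^⊥` supplies such a basis; choosing it is the consumer's one line), any `D`, any `φ : ℝ → ℝ`: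
* §1 `fc b μ = Σ_i μ_i |b_i⟩⟨b_i|` (functional calculus on the eigenbasis: `φ(H) = fc b (φ ∘ λ)`), `fc_basis`, **`inner_fc`** `⟨v, fc v⟩ = Σ μ_i⟨b_i,v⟩²`,
  `norm_sq_eq_sum_inner_sq` (Parseval), **`norm_sq_fc`**, **`eq_fc_of_eigen`** (`H bᵢ = λᵢbᵢ ∀ i ⇒ H = fc b λ`).
* §2 **`LL_iff`**: the operator form of (LL) on `phys` — `∀ v ∈ phys, m²‖v‖² ≤ ‖Hv‖²` — is EQUIVALENT to `∀ i ∈ S, m ≤ |λᵢ|` (`m ≥ 0`);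
  **`arch`** = THE IMPLICATION: (MI) `∀ v, ⟨v, φ(H)v⟩ ≤ ⟨v, Dv⟩` ∧ (LL) `∀ i ∈ S, m ≤ |λᵢ|` ∧ `∀ x, m ≤ |x| → c ≤ φ(x)` ⇒ `∀ v ∈ phys, c‖v‖² ≤ ⟨v, Dv⟩`;
  **`arch_mono`** (the «φ even, non-decreasing in |x|» form, `c = φ(m)`); `arch_operator` (with (LL) in operator form via `LL_iff`).
* §3 the Padé family `phiA a x = ½x²∕(1 + |x|∕a)²`: `phiA_nonneg ∕ _zero ∕ _neg` (even), `phiA_eq` (`= (a²∕2)(|x|∕(a+|x|))²`), **`phiA_mono_abs`**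
  (`0 ≤ m ≤ |x| ⇒ φ_a(m) ≤ φ_a(x)`, `a > 0`), `phiA_le` (saturation `≤ a²∕2`); **`phi2_budget`**: for `ε, β ≥ 0`,
  `φ₂(2ε(1 − 2βε)) ≥ 2ε² − (4 + 8β)ε³` — lens 1's `C = 4 + 8β`; and **`cc_ii_of_MI_LL`**: the three hypotheses at `φ = φ₂`, `m = f(1 − βf)`,
  `f = 2ε` give `∀ v ∈ phys, (2ε² − (4 + 8β)ε³)‖v‖² ≤ ⟨v, Dv⟩`.

HONEST FRAMING: [folklore] finite-dimensional spectral bookkeeping + one-variable real inequalities; (MI₂) and (LL_β) are HYPOTHESES here exactly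
as in lens 1's architecture («(MI₂) proved flat, measured curved; sizes not verdicts») — nothing of either is proved in this file, nothing of
Bałaban's is instantiated, no toy object is constructed; NOT a letter move (PRICING-NE7 v50: EJ-1b′ M tag (I), H1L ∕ H1L-EJ XL−); T-50-10 honoured.
NE7 NOT PRINTED ∕ NOT PROVED; spine 0∕9; FIXED FINITE T⁴, rung (B)+1; NOT infinite volume, NOT mass gap, NOT Clay.  HONEST DEPENDENCY: continuum YM
on T⁴ ⇐ BetaPertH ∧ nine spine estimates (0/9 proved); BetaPertH ⇐ (D1) ∧ (D4) ∧ CAP+tail; G-an2-4 gates asym, D1 and NE2/3/4.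
-/

noncomputable section

open Finset RealInnerProductSpace

namespace Summit.QuantumFields.BalabanUV.T4Continuum.NE7EJDefectSpectral

variable {ι : Type*} [Fintype ι] {E : Type*} [NormedAddCommGroup E] [InnerProductSpace ℝ E]

/-! ### §1 Functional calculus on an orthonormal eigenbasis -/

section FC

variable (b : OrthonormalBasis ι ℝ E) (μ : ι → ℝ)

/-- `fc b μ := Σ_i μ_i |b_i⟩⟨b_i|` — the self-adjoint operator with eigenbasis `b` and eigenvalues `μ`; `φ(H) = fc b (φ ∘ λ)` when `H bᵢ = λᵢ bᵢ`.
[folklore] -/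
def fc : E →ₗ[ℝ] E where
  toFun v := ∑ i, (μ i * ⟪b i, v⟫) • b i
  map_add' v w := by
    simp only [inner_add_right, mul_add, add_smul, sum_add_distrib]
  map_smul' c v := by
    simp only [real_inner_smul_right, RingHom.id_apply, smul_sum, smul_smul]
    exact sum_congr rfl fun i _ => by ring_nf

/-- unfolding. [folklore] -/
theorem fc_apply (v : E) : fc b μ v = ∑ i, (μ i * ⟪b i, v⟫) • b i := rfl

/-- `⟨b_j, b_i⟩ = δ_{ji}`. [folklore] -/
theorem inner_basis_basis [DecidableEq ι] (j i : ι) : ⟪b j, b i⟫ = if j = i then (1:ℝ) else 0 :=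
  orthonormal_iff_ite.mp b.orthonormal j i

/-- `⟨b_j, fc v⟩ = μ_j ⟨b_j, v⟩`. [folklore] -/
theorem inner_basis_fc [DecidableEq ι] (j : ι) (v : E) : ⟪b j, fc b μ v⟫ = μ j * ⟪b j, v⟫ := by
  rw [fc_apply, inner_sum, Finset.sum_eq_single j]
  · rw [real_inner_smul_right, inner_basis_basis, if_pos rfl, mul_one]
  · intro i _ hij; rw [real_inner_smul_right, inner_basis_basis, if_neg (Ne.symm hij), mul_zero]
  · simp

/-- `fc` acts diagonally: `fc (b j) = μ_j b_j`. [folklore] -/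
theorem fc_basis [DecidableEq ι] (j : ι) : fc b μ (b j) = μ j • b j := by
  rw [fc_apply, Finset.sum_eq_single j]
  · rw [inner_basis_basis, if_pos rfl, mul_one]
  · intro i _ hij; rw [inner_basis_basis, if_neg hij, mul_zero, zero_smul]
  · simp

/-- **the quadratic form of `fc`**: `⟨v, fc v⟩ = Σ_i μ_i ⟨b_i, v⟩²`. [folklore] -/
theorem inner_fc (v : E) : ⟪v, fc b μ v⟫ = ∑ i, μ i * ⟪b i, v⟫ ^ 2 := by
  rw [fc_apply, inner_sum]
  exact sum_congr rfl fun i _ => by rw [real_inner_smul_right, real_inner_comm (b i) v, sq]; ring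

/-- Parseval: `‖v‖² = Σ_i ⟨b_i, v⟩²`. [folklore] -/
theorem norm_sq_eq_sum_inner_sq (v : E) : ‖v‖ ^ 2 = ∑ i, ⟪b i, v⟫ ^ 2 := by
  rw [← real_inner_self_eq_norm_sq, ← b.sum_inner_mul_inner v v]
  exact sum_congr rfl fun i _ => by rw [real_inner_comm (b i) v, sq]

/-- `‖fc v‖² = Σ_i μ_i² ⟨b_i, v⟩²`. [folklore] -/
theorem norm_sq_fc (v : E) : ‖fc b μ v‖ ^ 2 = ∑ i, μ i ^ 2 * ⟪b i, v⟫ ^ 2 := by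
  rw [← real_inner_self_eq_norm_sq, fc_apply, b.orthonormal.inner_sum]
  exact sum_congr rfl fun i _ => by simp; ring

/-- **eigen-dictionary**: a linear map with `H bᵢ = λᵢ bᵢ` for all `i` IS `fc b λ`. [folklore] -/
theorem eq_fc_of_eigen [DecidableEq ι] (H : E →ₗ[ℝ] E) (lam : ι → ℝ) (hH : ∀ i, H (b i) = lam i • b i) : H = fc b lam :=
  b.toBasis.ext fun i => by rw [OrthonormalBasis.coe_toBasis, hH, fc_basis]

end FC

/-! ### §2 The architecture: (MI) ∧ (LL) ⇒ (cc′)(ii) -/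

section Arch

variable (b : OrthonormalBasis ι ℝ E) (lam : ι → ℝ) (S : Finset ι)

/-- on `phys := {v : ⟨b_i, v⟩ = 0 ∀ i ∉ S}` Parseval runs over `S` only. [folklore] -/
theorem norm_sq_eq_sum_phys {v : E} (hv : ∀ i ∉ S, ⟪b i, v⟫ = 0) : ‖v‖ ^ 2 = ∑ i ∈ S, ⟪b i, v⟫ ^ 2 := by
  rw [norm_sq_eq_sum_inner_sq b, ← sum_subset (subset_univ S)]
  intro i _ hi; rw [hv i hi]; ring

/-- **(LL), operator form ⇔ eigenvalue form**: for `m ≥ 0` and `H = fc b λ` (i.e. `H bᵢ = λᵢ bᵢ`), `m²‖v‖² ≤ ‖Hv‖²` for every `v ∈ phys`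
IFF `m ≤ |λᵢ|` for every physical index `i ∈ S` — lens 1's «spec(Hess_f|phys) ∩ (−m, m) = ∅». [folklore] -/
theorem LL_iff [DecidableEq ι] {m : ℝ} (hm : 0 ≤ m) :
    (∀ v : E, (∀ i ∉ S, ⟪b i, v⟫ = 0) → m ^ 2 * ‖v‖ ^ 2 ≤ ‖fc b lam v‖ ^ 2) ↔ ∀ i ∈ S, m ≤ |lam i| := by
  constructor
  · intro h i hi
    have hv : ∀ j ∉ S, ⟪b j, b i⟫ = 0 := fun j hj => by
      rw [inner_basis_basis, if_neg]; rintro rfl; exact hj hi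
    have := h (b i) hv
    rw [fc_basis, norm_smul, b.orthonormal.1 i, mul_one, Real.norm_eq_abs, one_pow, mul_one, sq_abs] at this
    nlinarith [abs_nonneg (lam i), sq_abs (lam i)]
  · intro h v hv
    rw [norm_sq_fc, norm_sq_eq_sum_inner_sq b v, mul_sum]
    refine sum_le_sum fun i _ => ?_
    by_cases hi : i ∈ S
    · have h1 : m ^ 2 ≤ lam i ^ 2 := by
        rw [← sq_abs (lam i)]; exact pow_le_pow_left₀ hm (h i hi) 2
      exact mul_le_mul_of_nonneg_right h1 (sq_nonneg _)
    · rw [hv i hi]; simp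

/-- **THE ARCHITECTURE LEMMA** (lens 1 ▶v3.163 (5) ∕ ▶v3.164 (v)): if (MI) `⟨v, φ(H)v⟩ ≤ ⟨v, Dv⟩` for ALL `v` (`φ(H) = fc b (φ ∘ λ)`), (LL) every physical
eigenvalue has `|λᵢ| ≥ m`, and `φ ≥ c` on `{|x| ≥ m}`, then `c‖v‖² ≤ ⟨v, Dv⟩` for every `v ∈ phys` — i.e. `λ_min(D|phys) ≥ c`. [folklore] -/
theorem arch (φ : ℝ → ℝ) (D : E → E) {m c : ℝ}
    (hMI : ∀ v : E, ⟪v, fc b (φ ∘ lam) v⟫ ≤ ⟪v, D v⟫) (hLL : ∀ i ∈ S, m ≤ |lam i|) (hφ : ∀ x, m ≤ |x| → c ≤ φ x)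
    {v : E} (hv : ∀ i ∉ S, ⟪b i, v⟫ = 0) : c * ‖v‖ ^ 2 ≤ ⟪v, D v⟫ := by
  refine le_trans ?_ (hMI v)
  rw [inner_fc, norm_sq_eq_sum_inner_sq b v, mul_sum]
  refine sum_le_sum fun i _ => ?_
  by_cases hi : i ∈ S
  · exact mul_le_mul_of_nonneg_right (hφ _ (hLL i hi)) (sq_nonneg _)
  · rw [hv i hi]; simp

/-- the «φ even, non-decreasing in |x|» form: `c = φ(m)`. [folklore] -/
theorem arch_mono (φ : ℝ → ℝ) (D : E → E) {m : ℝ} (hmono : ∀ x, m ≤ |x| → φ m ≤ φ x)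
    (hMI : ∀ v : E, ⟪v, fc b (φ ∘ lam) v⟫ ≤ ⟪v, D v⟫) (hLL : ∀ i ∈ S, m ≤ |lam i|)
    {v : E} (hv : ∀ i ∉ S, ⟪b i, v⟫ = 0) : φ m * ‖v‖ ^ 2 ≤ ⟪v, D v⟫ :=
  arch b lam S φ D hMI hLL hmono hv

/-- the same with (LL) in OPERATOR form (`m²‖v‖² ≤ ‖Hv‖²` on phys, `m ≥ 0`). [folklore] -/
theorem arch_operator [DecidableEq ι] (φ : ℝ → ℝ) (D : E → E) {m : ℝ} (hm : 0 ≤ m) (hmono : ∀ x, m ≤ |x| → φ m ≤ φ x)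
    (hMI : ∀ v : E, ⟪v, fc b (φ ∘ lam) v⟫ ≤ ⟪v, D v⟫)
    (hLL : ∀ v : E, (∀ i ∉ S, ⟪b i, v⟫ = 0) → m ^ 2 * ‖v‖ ^ 2 ≤ ‖fc b lam v‖ ^ 2)
    {v : E} (hv : ∀ i ∉ S, ⟪b i, v⟫ = 0) : φ m * ‖v‖ ^ 2 ≤ ⟪v, D v⟫ :=
  arch_mono b lam S φ D hmono hMI ((LL_iff b lam S hm).mp hLL) hv

end Arch

/-! ### §3 The Padé family `φ_a` and the `φ₂` budget -/

/-- lens 1's `φ_a(x) := ½x²∕(1 + |x|∕a)²` (`φ₂ = 2x²∕(2 + |x|)²`). [folklore] -/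
def phiA (a x : ℝ) : ℝ := (1 / 2) * x ^ 2 / (1 + |x| / a) ^ 2

/-- `0 ≤ φ_a`. [folklore] -/
theorem phiA_nonneg (a x : ℝ) : 0 ≤ phiA a x := by unfold phiA; positivity

/-- `φ_a(0) = 0`. [folklore] -/
theorem phiA_zero (a : ℝ) : phiA a 0 = 0 := by unfold phiA; simp

/-- `φ_a` is even. [folklore] -/
theorem phiA_neg (a x : ℝ) : phiA a (-x) = phiA a x := by unfold phiA; rw [abs_neg, neg_sq]

/-- for `a > 0`: `φ_a(x) = (a²∕2)·(|x|∕(a + |x|))²`. [folklore] -/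
theorem phiA_eq {a : ℝ} (ha : 0 < a) (x : ℝ) : phiA a x = (a ^ 2 / 2) * (|x| / (a + |x|)) ^ 2 := by
  unfold phiA
  have h1 : a + |x| ≠ 0 := by positivity
  have h2 : 1 + |x| / a ≠ 0 := by positivity
  rw [← sq_abs x]
  field_simp

/-- `φ₂(x) = 2x²∕(2 + |x|)²`. [folklore] -/
theorem phiA_two (x : ℝ) : phiA 2 x = 2 * x ^ 2 / (2 + |x|) ^ 2 := by
  rw [phiA_eq two_pos, ← sq_abs x]; field_simp

/-- `t ↦ t∕(a + t)` is non-decreasing on `t ≥ 0` (`a > 0`). [folklore] -/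
theorem div_add_mono {a s t : ℝ} (ha : 0 < a) (hs : 0 ≤ s) (hst : s ≤ t) : s / (a + s) ≤ t / (a + t) := by
  rw [div_le_div_iff₀ (by positivity) (by linarith)]
  nlinarith

/-- **`φ_a` is non-decreasing in `|x|`**: `0 ≤ m ≤ |x| ⇒ φ_a(m) ≤ φ_a(x)` (`a > 0`) — the property the architecture consumes. [folklore] -/
theorem phiA_mono_abs {a m x : ℝ} (ha : 0 < a) (hm : 0 ≤ m) (hmx : m ≤ |x|) : phiA a m ≤ phiA a x := by
  rw [phiA_eq ha, phiA_eq ha, abs_of_nonneg hm]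
  have h1 : 0 ≤ m / (a + m) := by positivity
  have h2 := div_add_mono ha hm hmx
  gcongr

/-- saturation: `φ_a(x) ≤ a²∕2` (`a > 0`). [folklore] -/
theorem phiA_le {a : ℝ} (ha : 0 < a) (x : ℝ) : phiA a x ≤ a ^ 2 / 2 := by
  rw [phiA_eq ha]
  have h : |x| / (a + |x|) ≤ 1 := by rw [div_le_one (by positivity)]; linarith [abs_nonneg x]
  have h0 : 0 ≤ |x| / (a + |x|) := by positivity
  calc a ^ 2 / 2 * (|x| / (a + |x|)) ^ 2 ≤ a ^ 2 / 2 * 1 ^ 2 := by gcongr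
    _ = a ^ 2 / 2 := by ring

/-- **THE `φ₂` BUDGET** (lens 1: «φ₂(f(1 − βf)) = 2ε²(1 − 2βε)²∕(1 + ε − 2βε²)² ≥ 2ε² − (4 + 8β)ε³», `f = 2ε`): for all `ε, β ≥ 0`,
`2ε² − (4 + 8β)ε³ ≤ φ₂(2ε(1 − 2βε))`. [folklore] -/
theorem phi2_budget {ε β : ℝ} (hε : 0 ≤ ε) (hβ : 0 ≤ β) : 2 * ε ^ 2 - (4 + 8 * β) * ε ^ 3 ≤ phiA 2 (2 * ε * (1 - 2 * β * ε)) := by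
  by_cases hbig : 1 ≤ (2 + 4 * β) * ε
  · -- the budget is non-positive
    have : 2 * ε ^ 2 - (4 + 8 * β) * ε ^ 3 = 2 * ε ^ 2 * (1 - (2 + 4 * β) * ε) := by ring
    rw [this]
    exact le_trans (mul_nonpos_of_nonneg_of_nonpos (by positivity) (by linarith)) (phiA_nonneg _ _)
  · rw [not_le] at hbig
    -- here `u := 1 − 2βε ∈ (½, 1]` and the argument is non-negative
    set u := 1 - 2 * β * ε with hu
    have hu1 : u ≤ 1 := by rw [hu]; nlinarith
    have hu0 : 1 / 2 ≤ u := by rw [hu]; nlinarith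
    have hx : 0 ≤ 2 * ε * u := by positivity
    rw [phiA_two, abs_of_nonneg hx]
    rw [le_div_iff₀ (by positivity)]
    -- `(2ε² − (4+8β)ε³)(2 + 2εu)² ≤ 2(2εu)²`; with `4βε = 2(1 − u)`: LHS = 2ε²(2u − 1 − 2ε)·4(1 + εu)²
    have hβε : 4 * β * ε = 2 * (1 - u) := by rw [hu]; ring
    have key : (2 * u - 1 - 2 * ε) * (1 + ε * u) ^ 2 ≤ u ^ 2 := by
      nlinarith [sq_nonneg (u - 1), mul_nonneg hε (sub_nonneg.mpr hu1), sq_nonneg ε, mul_nonneg hε hε,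
        mul_nonneg (mul_nonneg hε hε) (sub_nonneg.mpr hu1), mul_nonneg (mul_nonneg hε hε) hε, hu0]
    have e1 : (2 * ε ^ 2 - (4 + 8 * β) * ε ^ 3) * (2 + 2 * ε * u) ^ 2 = 8 * ε ^ 2 * ((2 * u - 1 - 2 * ε) * (1 + ε * u) ^ 2) := by
      have : (4 + 8 * β) * ε = 4 * ε + 2 * (4 * β * ε) := by ring
      calc (2 * ε ^ 2 - (4 + 8 * β) * ε ^ 3) * (2 + 2 * ε * u) ^ 2
          = ε ^ 2 * (2 - (4 + 8 * β) * ε) * (2 + 2 * ε * u) ^ 2 := by ring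
        _ = ε ^ 2 * (2 - (4 * ε + 2 * (4 * β * ε))) * (2 + 2 * ε * u) ^ 2 := by rw [this]
        _ = 8 * ε ^ 2 * ((2 * u - 1 - 2 * ε) * (1 + ε * u) ^ 2) := by rw [hβε]; ring
    rw [e1]
    have e2 : 2 * (2 * ε * u) ^ 2 = 8 * ε ^ 2 * u ^ 2 := by ring
    rw [e2]
    exact mul_le_mul_of_nonneg_left key (by positivity)

/-- **(cc′)(ii) FROM (MI₂) ∧ (LL_β)** — lens 1's three lines assembled: with `f = 2ε`, `m = f(1 − βf) ≥ 0`, (MI₂) for `φ₂` on all of `E` and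
(LL_β) on the physical indices, every `v ∈ phys` has `(2ε² − (4 + 8β)ε³)‖v‖² ≤ ⟨v, Dv⟩`. [folklore] -/
theorem cc_ii_of_MI_LL (b : OrthonormalBasis ι ℝ E) (lam : ι → ℝ) (S : Finset ι) (D : E → E) {ε β : ℝ} (hε : 0 ≤ ε) (hβ : 0 ≤ β)
    (hm : 0 ≤ 2 * ε * (1 - 2 * β * ε))
    (hMI : ∀ v : E, ⟪v, fc b (phiA 2 ∘ lam) v⟫ ≤ ⟪v, D v⟫) (hLL : ∀ i ∈ S, 2 * ε * (1 - 2 * β * ε) ≤ |lam i|)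
    {v : E} (hv : ∀ i ∉ S, ⟪b i, v⟫ = 0) : (2 * ε ^ 2 - (4 + 8 * β) * ε ^ 3) * ‖v‖ ^ 2 ≤ ⟪v, D v⟫ := by
  have h := arch_mono b lam S (phiA 2) D (fun x hx => phiA_mono_abs two_pos hm hx) hMI hLL hv
  exact le_trans (mul_le_mul_of_nonneg_right (phi2_budget hε hβ) (sq_nonneg _)) h

end Summit.QuantumFields.BalabanUV.T4Continuum.NE7EJDefectSpectral

end
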